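import Summits.QuantumFields.BalabanUV.Beta.GAN24.CombBorderWordsZero
import Summits.QuantumFields.BalabanUV.Beta.GAN24.CombEEWordTransfer
import Summits.QuantumFields.BalabanUV.Beta.GAN24.CombWWordZero
import Summits.QuantumFields.BalabanUV.Beta.GAN24.DressedSourceExchangeWords

/-!
# `BalabanUV.Beta.GAN24.CombForcingWordsLevelZero` — binder row G-an2-4 ∕ (CONV-C), TRANSFER-III, the (III′) (C)-campaign's supplier `hB0` AT LEVEL `0`: **THE TWO EXCHANGE WORDS OF THE
# ff ZERO MODE OF THE COMB CHART'S E-FRAME FORCING AT LEVEL `0` ARE THE TWO `S^E ⊗ S^E` NUMBERS** — leaf-04 g66's 30 `DressedSourceExchangeWords.sum_box_tsum_direct_word_eq ∕ _swap_word_eq`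
# AT THE COMB DATA (an1's record `symTablesAn1S2`, comb root `ρ_c = toSite (ctrOff (d+1) Lc)`, transports `𝒯 ∕ 𝒯′` by `Ψ̂_S`): the sector split F6 `dM_comb_zero_split` in both slots of both
# words of F2's 21, the eighteen sector words evaluated BY NAME — `E′⊗E′` (E `CombEEWordTransfer`: the number), `E′⊗VH′` (D2), `VH′⊗E′` (B), `VH′⊗VH′` (leaf-04's 28 on F3's sockets),
# the ten multiplier words (leaf-04's 23 on the transported multiplier family, F2 ∕ F5 sockets)
# (G-an2-4 CRUX TEAM (2), leaf prover `b2b-balaban-gan24-formalise-leaf-01`, gen 86; journal [LEAF01-G86-INTENT-5])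

NOT IN PRINT; OUR BOOKKEEPING ([folklore] finite bookkeeping BY NAME over leaf-01 g86 B ∕ D2 ∕ E, g85 F2 ∕ F3 ∕ F5 ∕ F6, leaf-04 g66's 23 `MultiplierWordsZero`, 28 `VHWordsZeroBorder`, 30
`DressedSourceExchangeWords` (`tsum_direct_word_split ∕ tsum_swap_word_split`), 18′ `EEWordSwap.ee_word_value'`, 22 `ExchangeSlotResum` (covariance swap); 0 `def`, 0 cited fact, 0 `def … : Prop`,
0 sorry).  HONEST FRAMING (cell contract, verbatim): «discharging `BetaPertH` makes Bałaban's UV stability UNCONDITIONAL — a real constructive-QFT result; it is NOT the continuum limit and NOT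
the Clay problem.»  HONEST DEPENDENCY (verbatim): «continuum YM on T⁴ ⇐ BetaPertH ∧ nine spine estimates (0/9 proved); BetaPertH ⇐ (D1) ∧ (D4) ∧ CAP+tail; G-an2-4 gates asym, D1 and NE2/3/4.»

WHAT ([folklore]; generic `d`, `[NeZero Lc]`, LEVEL `0`, period `Lc`, all units `s_f s_m`, an1's record `symTablesAn1S2 d Lc cΛt`, colour constants `cE cVH cΛ`, ANY axes `(μ, ν, α, β)`; the
kernel root SPELLED `toSite (ctrOff (d+1) Lc)` (`= ctr (d+1) Lc` by `rfl`)).  With `X̃_0 = unitK s_f s_m (coDressKBmAt ρ_c Lc (KInvStep Lc 0))`, `𝒯S̃′_0 = Ψ̂ᵀ∘slotPsiS (ctrOff) Lc (unitS s_f s_m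
(SpureCombOf tabs cE cVH cΛ 0))∘Ψ̂`, `𝒯′M̃′_0 ρ w = Ψ̂ᵀ∘unitM s_f s_m (tabs.M 0) ρ w∘Ψ̂`, `FF[K] = Σ'_{(y,w)} 𝟙f(y_α)𝟙f(w_β)·K y w (inl α)(inl β)`, `K₁ = (Lc·s_m s_f·Lc^{−(d+2)})·((s_f s_m)⁻¹ s_f⁻² cE)`:
§1 `exists_sector_data_comb_zero` (one rate for the three level-`0` comb sectors); §2 **`sum_box_comb_direct_word_level0_eq`**:
`Σ_{c∈box Lc} Σ'_{u′} FF[(dM X̃_0 Lc 𝒯S̃′_0 𝒯′M̃′_0 μ c ∘ X̃_0) ∘ dM X̃_0 Lc 𝒯S̃′_0 𝒯′M̃′_0 ν u′] = −K₁²·s_f²·E·½·Lc^{d−1}·(Lc^{d+1} − Lc^{d−1})`, `E = [μ=ν][α=β] − [μ=β][α=ν]`;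
**`sum_box_comb_swap_word_level0_eq`**: `Σ_{c∈box Lc} Σ'_{u′} FF[(dM … ν u′ ∘ X̃_0) ∘ dM … μ c] = −K₁²·s_f²·E′·½·Lc^{d−1}·(Lc^{d+1} − Lc^{d−1})`, `E′ = [ν=μ][α=β] − [ν=β][α=μ]` — THE SAME TWO
NUMBERS AS THE (E) CHAIN'S.  With F2 `zmode_combForcing_inl_inl` (21), F5 (`K·W·K = 0`) and F4 ((L3c) at the comb) the ff zero mode of the comb forcing at level `0` is therefore leaf-04's
closed form `c·(−(s_f s_m σ₀)²Lc²)·(these two numbers)` — the `RespWordsLevelZero ∕ ForcingCellPairFormLevelZero` twin (`hB0 0` at the comb) is the NEXT file, not this one.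
Asserts NO value of Bałaban's tables beyond an1's ∕ an3's DEFINED ones; NOT `hB0`; NEVER «G-an2-4 closed» as (CONV-C); NOT D1, NOT `BetaPertH`, NOT continuum, NOT Clay.  2026-08-27; no existing file touched.
-/

noncomputable section

open Finset
open scoped BigOperators
open Literature.MathematicalPhysics.QuantumFieldTheory
open Literature.MathematicalPhysics.QuantumFieldTheory.Balaban1983to89
open Literature.MathematicalPhysics.QuantumFieldTheory.Balaban1983to89.Beta
open ExpKernelCalculus (Site MKer comp shiftK Decays BiLoc VertexFamily)
open OneStepResolventKernel (Fib LocStencil decays_mono biLoc_mono)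
open OneStepKernelFamily (KInvStep vertexOfK vertexFamily_vertexOfK)
open SecondOrderResponse (dM vertexOfM vertexFamily_vertexOfM)
open StepJetData (wilsonA locStencil_wilsonA locStencil_smul)
open AffineAveraging (box toSite)
open AveragingContoursRooted (ctr ctrOff ctrOff_mem_box)
open Summit.QuantumFields.BalabanUV.Beta.SymAveragingHessianCounts (symVhSAt)
open Summit.QuantumFields.BalabanUV.Beta.TameKernelCalculus (trK Loc Spr)
open Summit.QuantumFields.BalabanUV.Beta.AxialDressingRooted (coDressKBmAt decays_coDressKBmAt_KInvStep)
open Summit.QuantumFields.BalabanUV.Beta.HessKerDressedUnits (unitK unitS decays_unitK locStencil_unitS)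
open Summit.QuantumFields.BalabanUV.Beta.SecondOrderUnits (unitM)
open Summit.QuantumFields.BalabanUV.Beta.SymmetrisedStepJets (SymTables)
open Summit.QuantumFields.BalabanUV.Beta.SymSecondOrderTablesAn1 (symTablesAn1S2 symTablesAn1S2_V)
open Summit.QuantumFields.BalabanUV.Beta.CombChartStepJets (SpureCombOf)
open Summit.QuantumFields.BalabanUV.Beta.SymCorrectorKernel (psiKS)
open Summit.QuantumFields.BalabanUV.Beta.SymCorrectorFace (slotPsiS)
open Summit.QuantumFields.BalabanUV.Beta.GAN24.CombCubicStepTransport (locStencil_transportPsiS)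
open Summit.QuantumFields.BalabanUV.Beta.GAN24.CombTransportedBorder (pos_Lc locStencil_symVhS symVhS_inl_inl symVhS_translate symVhS_inr_fst_eq_zero symVhS_inr_snd_eq_zero
  transport_inl_inl transport_translate transport_inr_fst_eq_zero transport_inr_snd_eq_zero exists_locStencil_transport_symVhS)
open Summit.QuantumFields.BalabanUV.Beta.GAN24.CombForcingTwoFaceWords (exists_vertexFamily_transport_M)
open Summit.QuantumFields.BalabanUV.Beta.GAN24.CombWWordZero (transportM_translate)
open Summit.QuantumFields.BalabanUV.Beta.GAN24.CombForcingSectorSplit (dM_comb_zero_split E_zero_translate transport_translate_comb)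
open Summit.QuantumFields.BalabanUV.Beta.GAN24.ExchangeSlotResum (face_weight_periodic tsum_eq_tsum_of_cov twoFace_word_cov_of)
open Summit.QuantumFields.BalabanUV.Beta.GAN24.EEWordReduced (shiftK_dressedStep)
open Summit.QuantumFields.BalabanUV.Beta.GAN24.EEWordSwap (ee_word_value')
open Summit.QuantumFields.BalabanUV.Beta.GAN24.VHWordsZeroBorder (borderSlot_translate sum_box_border_border_words_eq_zero)
open Summit.QuantumFields.BalabanUV.Beta.GAN24.MultiplierWordsZero (tsum_right_vertexOfM_word_eq_zero tsum_left_vertexOfM_word_eq_zero tsum_vertexOfM_left_cov_word_eq_zero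
  tsum_vertexOfM_right_cov_word_eq_zero)
open Summit.QuantumFields.BalabanUV.Beta.GAN24.DressedSourceExchangeWords (tsum_direct_word_split tsum_swap_word_split)
open Summit.QuantumFields.BalabanUV.Beta.GAN24.CombVHEWordsZero (sum_box_transported_noFF_wilson_words_eq_zero)
open Summit.QuantumFields.BalabanUV.Beta.GAN24.CombBorderWordsZero (sum_box_transported_wilson_border_word_eq_zero sum_box_transported_border_wilson_swap_word_eq_zero)
open Summit.QuantumFields.BalabanUV.Beta.GAN24.CombEEWordTransfer (sum_box_transported_ee_word_eq)

namespace Summit.QuantumFields.BalabanUV.Beta.GAN24.CombForcingWordsLevelZero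

variable {d : ℕ} {Lc : ℕ} [NeZero Lc]

/-! ## §1 One rate for the three level-0 comb sectors -/

/-- [folklore] **DECAY DATA OF THE THREE LEVEL-0 COMB SECTORS AT ONE RATE** (an1-style record `tabs`, all units, any `cE cVH`, ANY multiplier vertex family `M` at a positive rate; the kernel
root spelled `toSite (ctrOff (d+1) Lc)`): `X̃_0` decays and `V^{E′}`, `V^{VH′}`, `V^M` are vertex families, all at one rate `δ > 0` (F6's `exists_sector_data_comb_succ` at level `0`). -/
theorem exists_sector_data_comb_zero (tabs : SymTables d Lc) (sf sm cE cVH : ℝ)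
    {M : Fin (d + 1) → Site (d + 1) → MKer (d + 1) (Fib d)} {CM δM : ℝ} (hM : VertexFamily M Lc CM δM) (hδM : 0 < δM) :
    ∃ δ CX Cv Cw Cm : ℝ, 0 < δ ∧ Decays (unitK sf sm (coDressKBmAt (toSite (ctrOff (d + 1) Lc)) Lc (KInvStep (d := d) Lc 0))) CX δ ∧
      VertexFamily (vertexOfK (unitK sf sm (coDressKBmAt (toSite (ctrOff (d + 1) Lc)) Lc (KInvStep (d := d) Lc 0))) Lc
        (unitS sf sm (fun κ u => comp (comp (trK (psiKS (ctrOff (d + 1) Lc) Lc)) (slotPsiS (ctrOff (d + 1) Lc) Lc (fun κ u => cE • wilsonA d κ u) κ u)) (psiKS (ctrOff (d + 1) Lc) Lc)))) Lc Cv δ ∧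
      VertexFamily (vertexOfK (unitK sf sm (coDressKBmAt (toSite (ctrOff (d + 1) Lc)) Lc (KInvStep (d := d) Lc 0))) Lc
        (unitS sf sm (fun κ u => comp (comp (trK (psiKS (ctrOff (d + 1) Lc) Lc)) (slotPsiS (ctrOff (d + 1) Lc) Lc (fun κ u => cVH • tabs.V κ u) κ u)) (psiKS (ctrOff (d + 1) Lc) Lc)))) Lc Cw δ ∧
      VertexFamily (vertexOfM (unitK sf sm (coDressKBmAt (toSite (ctrOff (d + 1) Lc)) Lc (KInvStep (d := d) Lc 0))) Lc M) Lc Cm δ := by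
  obtain ⟨δK, CK, hδK, -, hXd⟩ := decays_coDressKBmAt_KInvStep (d := d) (Lc := Lc) (ctrOff_mem_box (pos_Lc (Lc := Lc))) 0
  have hXu := decays_unitK (sf := sf) (sm := sm) hXd
  have hCX : 0 ≤ max |sf| |sm| * CK * max |sf| |sm| := hXu.nonneg (Sum.inl 0)
  have hCM : 0 ≤ CM := (hM 0 0).nonneg (Sum.inl 0)
  obtain ⟨CV, hV⟩ := tabs.hV 1 zero_le_one
  obtain ⟨C₁, δ₁, hδ₁, hT₁⟩ := locStencil_transportPsiS (pos_Lc (Lc := Lc)) (ctrOff_mem_box (pos_Lc (Lc := Lc))) (locStencil_smul cE (locStencil_wilsonA (d := d) zero_le_one)) one_pos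
  obtain ⟨C₂, δ₂, hδ₂, hT₂⟩ := locStencil_transportPsiS (pos_Lc (Lc := Lc)) (ctrOff_mem_box (pos_Lc (Lc := Lc))) (locStencil_smul cVH hV) one_pos
  set m : ℝ := min (min δK δM) (min δ₁ δ₂) with hm
  have hm0 : 0 < m := lt_min (lt_min hδK hδM) (lt_min hδ₁ hδ₂)
  have hX1 : Decays (unitK sf sm (coDressKBmAt (toSite (ctrOff (d + 1) Lc)) Lc (KInvStep (d := d) Lc 0))) (max |sf| |sm| * CK * max |sf| |sm|) m :=
    decays_mono hXu hCX le_rfl ((min_le_left _ _).trans (min_le_left _ _))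
  have hM1 : VertexFamily M Lc CM m := fun ρ' w => biLoc_mono (hM ρ' w) hCM ((min_le_left _ _).trans (min_le_right _ _))
  have hS1 := BalabanStepJets.locStencil_mono hT₁ ((hT₁ 0 0).nonneg (Sum.inl 0)) ((min_le_right _ _).trans (min_le_left _ _) : m ≤ δ₁)
  have hS2 := BalabanStepJets.locStencil_mono hT₂ ((hT₂ 0 0).nonneg (Sum.inl 0)) ((min_le_right _ _).trans (min_le_right _ _) : m ≤ δ₂)
  have hVE := vertexFamily_vertexOfK (N := Lc) hX1 hCX (locStencil_unitS (sf := sf) (sm := sm) hS1) hm0 le_rfl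
  have hVW := vertexFamily_vertexOfK (N := Lc) hX1 hCX (locStencil_unitS (sf := sf) (sm := sm) hS2) hm0 le_rfl
  have hVM := vertexFamily_vertexOfM hX1 hCX hM1 hm0 le_rfl
  exact ⟨m / 2, _, _, _, _, half_pos hm0, decays_mono hX1 hCX le_rfl (by linarith), hVE, hVW, hVM⟩

/-! ## §2 The two exchange words of the comb forcing at level 0 -/

section Words

variable {μ ν α β : Fin (d + 1)}

/-- NOT IN PRINT; OUR BOOKKEEPING ([folklore]; 30's DIRECT WORD AT THE COMB DATA).  **THE DIRECT EXCHANGE WORD OF THE COMB FORCING'S ff ZERO MODE AT LEVEL `0` IS THE `S^E ⊗ S^E` NUMBER**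
(an1's record `symTablesAn1S2 d Lc cΛt`, comb root spelled `toSite (ctrOff (d+1) Lc)`, all units, colour constants `cE cVH cΛ`, ANY axes):
`Σ_{c∈box Lc} Σ'_{u′} FF[(dM X̃_0 Lc 𝒯S̃′_0 𝒯′M̃′_0 μ c ∘ X̃_0) ∘ dM X̃_0 Lc 𝒯S̃′_0 𝒯′M̃′_0 ν u′] = −K₁²·s_f²·E·½·Lc^{d−1}·(Lc^{d+1} − Lc^{d−1})` — F6's split in both slots, 30's `tsum_direct_word_split`,
then E (`sum_box_transported_ee_word_eq` ⨾ `ee_word_value'`), D2, B, leaf-04's 28 on F3's sockets, and 23's five multiplier zeros on the transported multiplier family (F2 `exists_vertexFamily_transport_M`,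
F5 `transportM_translate`). -/
theorem sum_box_comb_direct_word_level0_eq (sf sm cΛt cE cVH cΛ : ℝ) :
    ∑ c ∈ box (d + 1) Lc, ∑' u' : Site (d + 1), ∑' yw : Site (d + 1) × Site (d + 1), (if yw.1 α % (Lc : ℤ) = (Lc : ℤ) - 1 then (1 : ℝ) else 0) * (if yw.2 β % (Lc : ℤ) = (Lc : ℤ) - 1 then (1 : ℝ) else 0) *
        comp (comp (dM (unitK sf sm (coDressKBmAt (toSite (ctrOff (d + 1) Lc)) Lc (KInvStep (d := d) Lc 0))) Lc
            (fun κ u => comp (comp (trK (psiKS (ctrOff (d + 1) Lc) Lc)) (slotPsiS (ctrOff (d + 1) Lc) Lc (unitS sf sm (SpureCombOf (symTablesAn1S2 d Lc cΛt) cE cVH cΛ 0)) κ u)) (psiKS (ctrOff (d + 1) Lc) Lc))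
            (fun ρ w => comp (comp (trK (psiKS (ctrOff (d + 1) Lc) Lc)) (unitM sf sm ((symTablesAn1S2 d Lc cΛt).M 0) ρ w)) (psiKS (ctrOff (d + 1) Lc) Lc)) μ (toSite c))
          (unitK sf sm (coDressKBmAt (toSite (ctrOff (d + 1) Lc)) Lc (KInvStep (d := d) Lc 0))))
          (dM (unitK sf sm (coDressKBmAt (toSite (ctrOff (d + 1) Lc)) Lc (KInvStep (d := d) Lc 0))) Lc
            (fun κ u => comp (comp (trK (psiKS (ctrOff (d + 1) Lc) Lc)) (slotPsiS (ctrOff (d + 1) Lc) Lc (unitS sf sm (SpureCombOf (symTablesAn1S2 d Lc cΛt) cE cVH cΛ 0)) κ u)) (psiKS (ctrOff (d + 1) Lc) Lc))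
            (fun ρ w => comp (comp (trK (psiKS (ctrOff (d + 1) Lc) Lc)) (unitM sf sm ((symTablesAn1S2 d Lc cΛt).M 0) ρ w)) (psiKS (ctrOff (d + 1) Lc) Lc)) ν u') yw.1 yw.2 (Sum.inl α) (Sum.inl β) =
      -(((((Lc : ℝ) * (sm * sf)) * ((((Lc ^ (0 + 1) : ℕ) : ℝ)) ^ (d + 1 + 1))⁻¹) * ((sf * sm)⁻¹ * (sf⁻¹ * sf⁻¹) * cE))) ^ 2 * (sf * sf) *
        (((if μ = ν ∧ α = β then (1 : ℝ) else 0) - (if μ = β ∧ α = ν then (1 : ℝ) else 0)) * ((1 / 2 : ℝ) * (Lc : ℝ) ^ (d - 1) * ((Lc : ℝ) ^ (d + 1) - (Lc : ℝ) ^ (d - 1)))) := by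
  classical
  have hLc : 1 ≤ Lc := Nat.one_le_iff_ne_zero.mpr (NeZero.ne Lc)
  have hr0 := ctrOff_mem_box (d := d + 1) (pos_Lc (Lc := Lc))
  obtain ⟨CM, δM, hδM, hM⟩ := exists_vertexFamily_transport_M (symTablesAn1S2 d Lc cΛt) sf sm 0
  have hMcov := transportM_translate (symTablesAn1S2 d Lc cΛt) sf sm 0
  obtain ⟨δ, CX, Cv, Cw, Cm, hδ, hXd, hVE, hVW, hVM⟩ := exists_sector_data_comb_zero (symTablesAn1S2 d Lc cΛt) sf sm cE cVH hM hδM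
  have hX : Spr (unitK sf sm (coDressKBmAt (toSite (ctrOff (d + 1) Lc)) Lc (KInvStep (d := d) Lc 0))) := ⟨_, _, hδ, hXd⟩
  have hLE : ∀ (κ : Fin (d + 1)) (u : Site (d + 1)), Loc (vertexOfK (unitK sf sm (coDressKBmAt (toSite (ctrOff (d + 1) Lc)) Lc (KInvStep (d := d) Lc 0))) Lc
      (unitS sf sm (fun κ u => comp (comp (trK (psiKS (ctrOff (d + 1) Lc) Lc)) (slotPsiS (ctrOff (d + 1) Lc) Lc (fun κ u => cE • wilsonA d κ u) κ u)) (psiKS (ctrOff (d + 1) Lc) Lc))) κ u) :=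
    fun κ u => ⟨_, _, _, _, hδ, hVE κ u⟩
  have hLW : ∀ (κ : Fin (d + 1)) (u : Site (d + 1)), Loc (vertexOfK (unitK sf sm (coDressKBmAt (toSite (ctrOff (d + 1) Lc)) Lc (KInvStep (d := d) Lc 0))) Lc
      (unitS sf sm (fun κ u => comp (comp (trK (psiKS (ctrOff (d + 1) Lc) Lc)) (slotPsiS (ctrOff (d + 1) Lc) Lc (fun κ u => cVH • (symTablesAn1S2 d Lc cΛt).V κ u) κ u)) (psiKS (ctrOff (d + 1) Lc) Lc))) κ u) :=
    fun κ u => ⟨_, _, _, _, hδ, hVW κ u⟩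
  have hLM : ∀ (κ : Fin (d + 1)) (u : Site (d + 1)), Loc (vertexOfM (unitK sf sm (coDressKBmAt (toSite (ctrOff (d + 1) Lc)) Lc (KInvStep (d := d) Lc 0))) Lc
      (fun ρ w => comp (comp (trK (psiKS (ctrOff (d + 1) Lc) Lc)) (unitM sf sm ((symTablesAn1S2 d Lc cΛt).M 0) ρ w)) (psiKS (ctrOff (d + 1) Lc) Lc)) κ u) :=
    fun κ u => ⟨_, _, _, _, hδ, hVM κ u⟩
  have hρα : ∀ y : Site (d + 1), |(if y α % (Lc : ℤ) = (Lc : ℤ) - 1 then (1 : ℝ) else 0)| ≤ 1 := fun y => by split_ifs <;> simp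
  have hρβ : ∀ w : Site (d + 1), |(if w β % (Lc : ℤ) = (Lc : ℤ) - 1 then (1 : ℝ) else 0)| ≤ 1 := fun w => by split_ifs <;> simp
  have hEcov : ∀ (κ : Fin (d + 1)) (u t : Site (d + 1)), vertexOfK (unitK sf sm (coDressKBmAt (toSite (ctrOff (d + 1) Lc)) Lc (KInvStep (d := d) Lc 0))) Lc
        (unitS sf sm (fun κ u => comp (comp (trK (psiKS (ctrOff (d + 1) Lc) Lc)) (slotPsiS (ctrOff (d + 1) Lc) Lc (fun κ u => cE • wilsonA d κ u) κ u)) (psiKS (ctrOff (d + 1) Lc) Lc))) κ (u + t) =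
      shiftK (-((Lc : ℤ) • t)) (vertexOfK (unitK sf sm (coDressKBmAt (toSite (ctrOff (d + 1) Lc)) Lc (KInvStep (d := d) Lc 0))) Lc
        (unitS sf sm (fun κ u => comp (comp (trK (psiKS (ctrOff (d + 1) Lc) Lc)) (slotPsiS (ctrOff (d + 1) Lc) Lc (fun κ u => cE • wilsonA d κ u) κ u)) (psiKS (ctrOff (d + 1) Lc) Lc))) κ u) :=
    fun κ u t => borderSlot_translate (r := ctrOff (d + 1) Lc) hLc sf sm 0 (transport_translate_comb (Lc := Lc) (fun κ' u' t' => E_zero_translate (Lc := Lc) cE κ' u' t')) κ u t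
  have hWcov : ∀ (κ : Fin (d + 1)) (u t : Site (d + 1)), vertexOfK (unitK sf sm (coDressKBmAt (toSite (ctrOff (d + 1) Lc)) Lc (KInvStep (d := d) Lc 0))) Lc
        (unitS sf sm (fun κ u => comp (comp (trK (psiKS (ctrOff (d + 1) Lc) Lc)) (slotPsiS (ctrOff (d + 1) Lc) Lc (fun κ u => cVH • (symTablesAn1S2 d Lc cΛt).V κ u) κ u)) (psiKS (ctrOff (d + 1) Lc) Lc))) κ (u + t) =
      shiftK (-((Lc : ℤ) • t)) (vertexOfK (unitK sf sm (coDressKBmAt (toSite (ctrOff (d + 1) Lc)) Lc (KInvStep (d := d) Lc 0))) Lc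
        (unitS sf sm (fun κ u => comp (comp (trK (psiKS (ctrOff (d + 1) Lc) Lc)) (slotPsiS (ctrOff (d + 1) Lc) Lc (fun κ u => cVH • (symTablesAn1S2 d Lc cΛt).V κ u) κ u)) (psiKS (ctrOff (d + 1) Lc) Lc))) κ u) :=
    fun κ u t => borderSlot_translate (r := ctrOff (d + 1) Lc) hLc sf sm 0 (transport_translate_comb (Lc := Lc) (fun κ' u' t' => symVhS_translate hLc cVH κ' u' t')) κ u t
  -- split both slots and the lattice sum
  simp only [dM_comb_zero_split (symTablesAn1S2 d Lc cΛt) sf sm cE cVH cΛ hXd hδ]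
  rw [Finset.sum_congr rfl fun c _ => tsum_direct_word_split (hLE μ (toSite c)) (hLW μ (toSite c)) (hLM μ (toSite c)) hX hVE hδ hVW hδ hVM hδ hρα hρβ ν (Sum.inl α) (Sum.inl β)]
  simp only [Finset.sum_add_distrib]
  -- the nine sector values
  obtain ⟨Cs, δs, hδs, hS⟩ := exists_locStencil_transport_symVhS (d := d) (Lc := Lc) cVH
  have z11 := (sum_box_transported_ee_word_eq (μ := μ) (ν := ν) (α := α) (β := β) hLc hr0 hr0 sf sm cE 0).trans (ee_word_value' (μ := μ) (ν := ν) (α := α) (β := β) hLc hr0 sf sm cE)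
  have z12 := sum_box_transported_wilson_border_word_eq_zero (μ := μ) (ν := ν) (α := α) (β := β) hLc hr0 hr0 sf sm cE 0 (locStencil_symVhS (Lc := Lc) cVH zero_le_one) one_pos
    (fun κ' t x z α' a => symVhS_inl_inl (Lc := Lc) cVH κ' t x z α' a) (fun κ u t => symVhS_translate hLc cVH κ u t) (fun κ t z w m b hz => symVhS_inr_fst_eq_zero (Lc := Lc) cVH κ t z w m b hz)
  have z13 : ∀ c : Site (d + 1), _ := fun c => tsum_right_vertexOfM_word_eq_zero hLc hr0 sf sm 0 hM hδM (hLE μ c) hρα hρβ ν (Sum.inl α) (Sum.inl β)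
  have z21 := (sum_box_transported_noFF_wilson_words_eq_zero (μ := μ) (ν := ν) (α := α) (β := β) hLc hr0 hr0 sf sm cE (locStencil_symVhS (Lc := Lc) cVH zero_le_one) one_pos
    (fun κ' t x z α' a => symVhS_inl_inl (Lc := Lc) cVH κ' t x z α' a) Lc).1
  have z22 := (sum_box_border_border_words_eq_zero (μ := μ) (ν := ν) (α := α) (β := β)
    (ρ₁ := fun y : Site (d + 1) => (if y α % (Lc : ℤ) = (Lc : ℤ) - 1 then (1 : ℝ) else 0)) (ρ₂ := fun w : Site (d + 1) => (if w β % (Lc : ℤ) = (Lc : ℤ) - 1 then (1 : ℝ) else 0))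
    hLc hr0 sf sm 0 hS hδs (transport_inl_inl (ctrOff (d + 1) Lc) (fun κ' t x z α' a => symVhS_inl_inl (Lc := Lc) cVH κ' t x z α' a))
    (transport_translate (ctrOff (d + 1) Lc) pos_Lc (fun κ u t => symVhS_translate hLc cVH κ u t))
    (transport_inr_fst_eq_zero (ctrOff (d + 1) Lc) (fun κ t z w m b hz => symVhS_inr_fst_eq_zero (Lc := Lc) cVH κ t z w m b hz))
    (transport_inr_snd_eq_zero (ctrOff (d + 1) Lc) (fun κ t z w a m hw => symVhS_inr_snd_eq_zero (Lc := Lc) cVH κ t z w a m hw))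
    hρα hρβ (fun y s => face_weight_periodic Lc α y s) (fun w s => face_weight_periodic Lc β w s) Lc).1
  have z23 : ∀ c : Site (d + 1), _ := fun c => tsum_right_vertexOfM_word_eq_zero hLc hr0 sf sm 0 hM hδM (hLW μ c) hρα hρβ ν (Sum.inl α) (Sum.inl β)
  have z31 : ∀ c : Site (d + 1), _ := fun c => tsum_vertexOfM_left_cov_word_eq_zero hLc hr0 sf sm 0 hM hδM hMcov hVE hδ hEcov
    (fun y s => face_weight_periodic Lc α y s) (fun w s => face_weight_periodic Lc β w s) hρα hρβ μ ν (Sum.inl α) (Sum.inl β) c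
  have z32 : ∀ c : Site (d + 1), _ := fun c => tsum_vertexOfM_left_cov_word_eq_zero hLc hr0 sf sm 0 hM hδM hMcov hVW hδ hWcov
    (fun y s => face_weight_periodic Lc α y s) (fun w s => face_weight_periodic Lc β w s) hρα hρβ μ ν (Sum.inl α) (Sum.inl β) c
  have z33 : ∀ c : Site (d + 1), _ := fun c => tsum_right_vertexOfM_word_eq_zero hLc hr0 sf sm 0 hM hδM (hLM μ c) hρα hρβ ν (Sum.inl α) (Sum.inl β)
  simp only [z13, z23, z31, z32, z33, Finset.sum_const_zero, add_zero, zero_add]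
  simp only [symTablesAn1S2_V, z12, z21, z22, add_zero]
  exact z11

/-- NOT IN PRINT; OUR BOOKKEEPING ([folklore]; 30's SWAP WORD AT THE COMB DATA).  **THE SWAP EXCHANGE WORD OF THE COMB FORCING'S ff ZERO MODE AT LEVEL `0` IS THE SWAP `S^E ⊗ S^E` NUMBER**:
`Σ_{c∈box Lc} Σ'_{u′} FF[(dM X̃_0 Lc 𝒯S̃′_0 𝒯′M̃′_0 ν u′ ∘ X̃_0) ∘ dM X̃_0 Lc 𝒯S̃′_0 𝒯′M̃′_0 μ c] = −K₁²·s_f²·E′·½·Lc^{d−1}·(Lc^{d+1} − Lc^{d−1})`, `E′ = [ν=μ][α=β] − [ν=β][α=μ]` — 30's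
`tsum_swap_word_split`; the `E′⊗E′` swap word moves its lattice bond to the right slot by joint covariance (22 `tsum_eq_tsum_of_cov ∕ twoFace_word_cov_of`) and is E's number with `(μ, ν)`
exchanged; D2's swap, B's swap, 28's swap on F3's sockets, 23's multiplier zeros. -/
theorem sum_box_comb_swap_word_level0_eq (sf sm cΛt cE cVH cΛ : ℝ) :
    ∑ c ∈ box (d + 1) Lc, ∑' u' : Site (d + 1), ∑' yw : Site (d + 1) × Site (d + 1), (if yw.1 α % (Lc : ℤ) = (Lc : ℤ) - 1 then (1 : ℝ) else 0) * (if yw.2 β % (Lc : ℤ) = (Lc : ℤ) - 1 then (1 : ℝ) else 0) *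
        comp (comp (dM (unitK sf sm (coDressKBmAt (toSite (ctrOff (d + 1) Lc)) Lc (KInvStep (d := d) Lc 0))) Lc
            (fun κ u => comp (comp (trK (psiKS (ctrOff (d + 1) Lc) Lc)) (slotPsiS (ctrOff (d + 1) Lc) Lc (unitS sf sm (SpureCombOf (symTablesAn1S2 d Lc cΛt) cE cVH cΛ 0)) κ u)) (psiKS (ctrOff (d + 1) Lc) Lc))
            (fun ρ w => comp (comp (trK (psiKS (ctrOff (d + 1) Lc) Lc)) (unitM sf sm ((symTablesAn1S2 d Lc cΛt).M 0) ρ w)) (psiKS (ctrOff (d + 1) Lc) Lc)) ν u')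
          (unitK sf sm (coDressKBmAt (toSite (ctrOff (d + 1) Lc)) Lc (KInvStep (d := d) Lc 0))))
          (dM (unitK sf sm (coDressKBmAt (toSite (ctrOff (d + 1) Lc)) Lc (KInvStep (d := d) Lc 0))) Lc
            (fun κ u => comp (comp (trK (psiKS (ctrOff (d + 1) Lc) Lc)) (slotPsiS (ctrOff (d + 1) Lc) Lc (unitS sf sm (SpureCombOf (symTablesAn1S2 d Lc cΛt) cE cVH cΛ 0)) κ u)) (psiKS (ctrOff (d + 1) Lc) Lc))
            (fun ρ w => comp (comp (trK (psiKS (ctrOff (d + 1) Lc) Lc)) (unitM sf sm ((symTablesAn1S2 d Lc cΛt).M 0) ρ w)) (psiKS (ctrOff (d + 1) Lc) Lc)) μ (toSite c)) yw.1 yw.2 (Sum.inl α) (Sum.inl β) =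
      -(((((Lc : ℝ) * (sm * sf)) * ((((Lc ^ (0 + 1) : ℕ) : ℝ)) ^ (d + 1 + 1))⁻¹) * ((sf * sm)⁻¹ * (sf⁻¹ * sf⁻¹) * cE))) ^ 2 * (sf * sf) *
        (((if ν = μ ∧ α = β then (1 : ℝ) else 0) - (if ν = β ∧ α = μ then (1 : ℝ) else 0)) * ((1 / 2 : ℝ) * (Lc : ℝ) ^ (d - 1) * ((Lc : ℝ) ^ (d + 1) - (Lc : ℝ) ^ (d - 1)))) := by
  classical
  have hLc : 1 ≤ Lc := Nat.one_le_iff_ne_zero.mpr (NeZero.ne Lc)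
  have hr0 := ctrOff_mem_box (d := d + 1) (pos_Lc (Lc := Lc))
  obtain ⟨CM, δM, hδM, hM⟩ := exists_vertexFamily_transport_M (symTablesAn1S2 d Lc cΛt) sf sm 0
  have hMcov := transportM_translate (symTablesAn1S2 d Lc cΛt) sf sm 0
  obtain ⟨δ, CX, Cv, Cw, Cm, hδ, hXd, hVE, hVW, hVM⟩ := exists_sector_data_comb_zero (symTablesAn1S2 d Lc cΛt) sf sm cE cVH hM hδM
  have hX : Spr (unitK sf sm (coDressKBmAt (toSite (ctrOff (d + 1) Lc)) Lc (KInvStep (d := d) Lc 0))) := ⟨_, _, hδ, hXd⟩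
  have hXs : ∀ t : Site (d + 1), shiftK (-((Lc : ℤ) • t)) (unitK sf sm (coDressKBmAt (toSite (ctrOff (d + 1) Lc)) Lc (KInvStep (d := d) Lc 0))) =
      unitK sf sm (coDressKBmAt (toSite (ctrOff (d + 1) Lc)) Lc (KInvStep (d := d) Lc 0)) := fun t => shiftK_dressedStep (r := ctrOff (d + 1) Lc) hLc sf sm 0 t
  have hLE : ∀ (κ : Fin (d + 1)) (u : Site (d + 1)), Loc (vertexOfK (unitK sf sm (coDressKBmAt (toSite (ctrOff (d + 1) Lc)) Lc (KInvStep (d := d) Lc 0))) Lc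
      (unitS sf sm (fun κ u => comp (comp (trK (psiKS (ctrOff (d + 1) Lc) Lc)) (slotPsiS (ctrOff (d + 1) Lc) Lc (fun κ u => cE • wilsonA d κ u) κ u)) (psiKS (ctrOff (d + 1) Lc) Lc))) κ u) :=
    fun κ u => ⟨_, _, _, _, hδ, hVE κ u⟩
  have hLW : ∀ (κ : Fin (d + 1)) (u : Site (d + 1)), Loc (vertexOfK (unitK sf sm (coDressKBmAt (toSite (ctrOff (d + 1) Lc)) Lc (KInvStep (d := d) Lc 0))) Lc
      (unitS sf sm (fun κ u => comp (comp (trK (psiKS (ctrOff (d + 1) Lc) Lc)) (slotPsiS (ctrOff (d + 1) Lc) Lc (fun κ u => cVH • (symTablesAn1S2 d Lc cΛt).V κ u) κ u)) (psiKS (ctrOff (d + 1) Lc) Lc))) κ u) :=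
    fun κ u => ⟨_, _, _, _, hδ, hVW κ u⟩
  have hLM : ∀ (κ : Fin (d + 1)) (u : Site (d + 1)), Loc (vertexOfM (unitK sf sm (coDressKBmAt (toSite (ctrOff (d + 1) Lc)) Lc (KInvStep (d := d) Lc 0))) Lc
      (fun ρ w => comp (comp (trK (psiKS (ctrOff (d + 1) Lc) Lc)) (unitM sf sm ((symTablesAn1S2 d Lc cΛt).M 0) ρ w)) (psiKS (ctrOff (d + 1) Lc) Lc)) κ u) :=
    fun κ u => ⟨_, _, _, _, hδ, hVM κ u⟩
  have hρα : ∀ y : Site (d + 1), |(if y α % (Lc : ℤ) = (Lc : ℤ) - 1 then (1 : ℝ) else 0)| ≤ 1 := fun y => by split_ifs <;> simp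
  have hρβ : ∀ w : Site (d + 1), |(if w β % (Lc : ℤ) = (Lc : ℤ) - 1 then (1 : ℝ) else 0)| ≤ 1 := fun w => by split_ifs <;> simp
  have hEcov : ∀ (κ : Fin (d + 1)) (u t : Site (d + 1)), vertexOfK (unitK sf sm (coDressKBmAt (toSite (ctrOff (d + 1) Lc)) Lc (KInvStep (d := d) Lc 0))) Lc
        (unitS sf sm (fun κ u => comp (comp (trK (psiKS (ctrOff (d + 1) Lc) Lc)) (slotPsiS (ctrOff (d + 1) Lc) Lc (fun κ u => cE • wilsonA d κ u) κ u)) (psiKS (ctrOff (d + 1) Lc) Lc))) κ (u + t) =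
      shiftK (-((Lc : ℤ) • t)) (vertexOfK (unitK sf sm (coDressKBmAt (toSite (ctrOff (d + 1) Lc)) Lc (KInvStep (d := d) Lc 0))) Lc
        (unitS sf sm (fun κ u => comp (comp (trK (psiKS (ctrOff (d + 1) Lc) Lc)) (slotPsiS (ctrOff (d + 1) Lc) Lc (fun κ u => cE • wilsonA d κ u) κ u)) (psiKS (ctrOff (d + 1) Lc) Lc))) κ u) :=
    fun κ u t => borderSlot_translate (r := ctrOff (d + 1) Lc) hLc sf sm 0 (transport_translate_comb (Lc := Lc) (fun κ' u' t' => E_zero_translate (Lc := Lc) cE κ' u' t')) κ u t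
  have hWcov : ∀ (κ : Fin (d + 1)) (u t : Site (d + 1)), vertexOfK (unitK sf sm (coDressKBmAt (toSite (ctrOff (d + 1) Lc)) Lc (KInvStep (d := d) Lc 0))) Lc
        (unitS sf sm (fun κ u => comp (comp (trK (psiKS (ctrOff (d + 1) Lc) Lc)) (slotPsiS (ctrOff (d + 1) Lc) Lc (fun κ u => cVH • (symTablesAn1S2 d Lc cΛt).V κ u) κ u)) (psiKS (ctrOff (d + 1) Lc) Lc))) κ (u + t) =
      shiftK (-((Lc : ℤ) • t)) (vertexOfK (unitK sf sm (coDressKBmAt (toSite (ctrOff (d + 1) Lc)) Lc (KInvStep (d := d) Lc 0))) Lc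
        (unitS sf sm (fun κ u => comp (comp (trK (psiKS (ctrOff (d + 1) Lc) Lc)) (slotPsiS (ctrOff (d + 1) Lc) Lc (fun κ u => cVH • (symTablesAn1S2 d Lc cΛt).V κ u) κ u)) (psiKS (ctrOff (d + 1) Lc) Lc))) κ u) :=
    fun κ u t => borderSlot_translate (r := ctrOff (d + 1) Lc) hLc sf sm 0 (transport_translate_comb (Lc := Lc) (fun κ' u' t' => symVhS_translate hLc cVH κ' u' t')) κ u t
  -- split both slots and the lattice sum
  simp only [dM_comb_zero_split (symTablesAn1S2 d Lc cΛt) sf sm cE cVH cΛ hXd hδ]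
  rw [Finset.sum_congr rfl fun c _ => tsum_swap_word_split (hLE μ (toSite c)) (hLW μ (toSite c)) (hLM μ (toSite c)) hX hVE hδ hVW hδ hVM hδ hρα hρβ ν (Sum.inl α) (Sum.inl β)]
  simp only [Finset.sum_add_distrib]
  -- the nine sector values (left slot on the lattice bond)
  obtain ⟨Cs, δs, hδs, hS⟩ := exists_locStencil_transport_symVhS (d := d) (Lc := Lc) cVH
  have swap : ∀ c : Site (d + 1), (∑' u' : Site (d + 1), ∑' yw : Site (d + 1) × Site (d + 1), (if yw.1 α % (Lc : ℤ) = (Lc : ℤ) - 1 then (1 : ℝ) else 0) * (if yw.2 β % (Lc : ℤ) = (Lc : ℤ) - 1 then (1 : ℝ) else 0) *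
        comp (comp (vertexOfK (unitK sf sm (coDressKBmAt (toSite (ctrOff (d + 1) Lc)) Lc (KInvStep (d := d) Lc 0))) Lc
            (unitS sf sm (fun κ u => comp (comp (trK (psiKS (ctrOff (d + 1) Lc) Lc)) (slotPsiS (ctrOff (d + 1) Lc) Lc (fun κ u => cE • wilsonA d κ u) κ u)) (psiKS (ctrOff (d + 1) Lc) Lc))) ν u')
          (unitK sf sm (coDressKBmAt (toSite (ctrOff (d + 1) Lc)) Lc (KInvStep (d := d) Lc 0))))
          (vertexOfK (unitK sf sm (coDressKBmAt (toSite (ctrOff (d + 1) Lc)) Lc (KInvStep (d := d) Lc 0))) Lc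
            (unitS sf sm (fun κ u => comp (comp (trK (psiKS (ctrOff (d + 1) Lc) Lc)) (slotPsiS (ctrOff (d + 1) Lc) Lc (fun κ u => cE • wilsonA d κ u) κ u)) (psiKS (ctrOff (d + 1) Lc) Lc))) μ c) yw.1 yw.2 (Sum.inl α) (Sum.inl β)) =
      ∑' u' : Site (d + 1), ∑' yw : Site (d + 1) × Site (d + 1), (if yw.1 α % (Lc : ℤ) = (Lc : ℤ) - 1 then (1 : ℝ) else 0) * (if yw.2 β % (Lc : ℤ) = (Lc : ℤ) - 1 then (1 : ℝ) else 0) *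
        comp (comp (vertexOfK (unitK sf sm (coDressKBmAt (toSite (ctrOff (d + 1) Lc)) Lc (KInvStep (d := d) Lc 0))) Lc
            (unitS sf sm (fun κ u => comp (comp (trK (psiKS (ctrOff (d + 1) Lc) Lc)) (slotPsiS (ctrOff (d + 1) Lc) Lc (fun κ u => cE • wilsonA d κ u) κ u)) (psiKS (ctrOff (d + 1) Lc) Lc))) ν c)
          (unitK sf sm (coDressKBmAt (toSite (ctrOff (d + 1) Lc)) Lc (KInvStep (d := d) Lc 0))))
          (vertexOfK (unitK sf sm (coDressKBmAt (toSite (ctrOff (d + 1) Lc)) Lc (KInvStep (d := d) Lc 0))) Lc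
            (unitS sf sm (fun κ u => comp (comp (trK (psiKS (ctrOff (d + 1) Lc) Lc)) (slotPsiS (ctrOff (d + 1) Lc) Lc (fun κ u => cE • wilsonA d κ u) κ u)) (psiKS (ctrOff (d + 1) Lc) Lc))) μ u') yw.1 yw.2 (Sum.inl α) (Sum.inl β) :=
    fun c => tsum_eq_tsum_of_cov (G := fun a b => ∑' yw : Site (d + 1) × Site (d + 1), (if yw.1 α % (Lc : ℤ) = (Lc : ℤ) - 1 then (1 : ℝ) else 0) * (if yw.2 β % (Lc : ℤ) = (Lc : ℤ) - 1 then (1 : ℝ) else 0) *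
        comp (comp (vertexOfK (unitK sf sm (coDressKBmAt (toSite (ctrOff (d + 1) Lc)) Lc (KInvStep (d := d) Lc 0))) Lc
            (unitS sf sm (fun κ u => comp (comp (trK (psiKS (ctrOff (d + 1) Lc) Lc)) (slotPsiS (ctrOff (d + 1) Lc) Lc (fun κ u => cE • wilsonA d κ u) κ u)) (psiKS (ctrOff (d + 1) Lc) Lc))) ν a)
          (unitK sf sm (coDressKBmAt (toSite (ctrOff (d + 1) Lc)) Lc (KInvStep (d := d) Lc 0))))
          (vertexOfK (unitK sf sm (coDressKBmAt (toSite (ctrOff (d + 1) Lc)) Lc (KInvStep (d := d) Lc 0))) Lc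
            (unitS sf sm (fun κ u => comp (comp (trK (psiKS (ctrOff (d + 1) Lc) Lc)) (slotPsiS (ctrOff (d + 1) Lc) Lc (fun κ u => cE • wilsonA d κ u) κ u)) (psiKS (ctrOff (d + 1) Lc) Lc))) μ b) yw.1 yw.2 (Sum.inl α) (Sum.inl β))
      (fun a b t => twoFace_word_cov_of (N := Lc) (fun a' t' => hEcov ν a' t') (fun b' t' => hEcov μ b' t') hXs
      (ρ₁ := fun y : Site (d + 1) => (if y α % (Lc : ℤ) = (Lc : ℤ) - 1 then (1 : ℝ) else 0)) (ρ₂ := fun w : Site (d + 1) => (if w β % (Lc : ℤ) = (Lc : ℤ) - 1 then (1 : ℝ) else 0))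
      (fun y s => face_weight_periodic Lc α y s) (fun w s => face_weight_periodic Lc β w s) a b t (Sum.inl α) (Sum.inl β)) c
  have z11 := (sum_box_transported_ee_word_eq (μ := ν) (ν := μ) (α := α) (β := β) hLc hr0 hr0 sf sm cE 0).trans (ee_word_value' (μ := ν) (ν := μ) (α := α) (β := β) hLc hr0 sf sm cE)
  have z12 := (sum_box_transported_noFF_wilson_words_eq_zero (μ := μ) (ν := ν) (α := α) (β := β) hLc hr0 hr0 sf sm cE (locStencil_symVhS (Lc := Lc) cVH zero_le_one) one_pos
    (fun κ' t x z α' a => symVhS_inl_inl (Lc := Lc) cVH κ' t x z α' a) Lc).2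
  have z13 : ∀ c : Site (d + 1), _ := fun c => tsum_vertexOfM_right_cov_word_eq_zero hLc hr0 sf sm 0 hM hδM hMcov hVE hδ hEcov
    (fun y s => face_weight_periodic Lc α y s) (fun w s => face_weight_periodic Lc β w s) hρα hρβ μ ν (Sum.inl α) (Sum.inl β) c
  have z21 := sum_box_transported_border_wilson_swap_word_eq_zero (μ := μ) (ν := ν) (α := α) (β := β) hLc hr0 hr0 sf sm cE 0 (locStencil_symVhS (Lc := Lc) cVH zero_le_one) one_pos
    (fun κ' t x z α' a => symVhS_inl_inl (Lc := Lc) cVH κ' t x z α' a) (fun κ u t => symVhS_translate hLc cVH κ u t) (fun κ t z w a m hw => symVhS_inr_snd_eq_zero (Lc := Lc) cVH κ t z w a m hw)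
  have z22 := (sum_box_border_border_words_eq_zero (μ := μ) (ν := ν) (α := α) (β := β)
    (ρ₁ := fun y : Site (d + 1) => (if y α % (Lc : ℤ) = (Lc : ℤ) - 1 then (1 : ℝ) else 0)) (ρ₂ := fun w : Site (d + 1) => (if w β % (Lc : ℤ) = (Lc : ℤ) - 1 then (1 : ℝ) else 0))
    hLc hr0 sf sm 0 hS hδs (transport_inl_inl (ctrOff (d + 1) Lc) (fun κ' t x z α' a => symVhS_inl_inl (Lc := Lc) cVH κ' t x z α' a))
    (transport_translate (ctrOff (d + 1) Lc) pos_Lc (fun κ u t => symVhS_translate hLc cVH κ u t))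
    (transport_inr_fst_eq_zero (ctrOff (d + 1) Lc) (fun κ t z w m b hz => symVhS_inr_fst_eq_zero (Lc := Lc) cVH κ t z w m b hz))
    (transport_inr_snd_eq_zero (ctrOff (d + 1) Lc) (fun κ t z w a m hw => symVhS_inr_snd_eq_zero (Lc := Lc) cVH κ t z w a m hw))
    hρα hρβ (fun y s => face_weight_periodic Lc α y s) (fun w s => face_weight_periodic Lc β w s) Lc).2
  have z23 : ∀ c : Site (d + 1), _ := fun c => tsum_vertexOfM_right_cov_word_eq_zero hLc hr0 sf sm 0 hM hδM hMcov hVW hδ hWcov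
    (fun y s => face_weight_periodic Lc α y s) (fun w s => face_weight_periodic Lc β w s) hρα hρβ μ ν (Sum.inl α) (Sum.inl β) c
  have z31 : ∀ c : Site (d + 1), _ := fun c => tsum_left_vertexOfM_word_eq_zero hLc hr0 sf sm 0 hM hδM (hLE μ c) hρα hρβ ν (Sum.inl α) (Sum.inl β)
  have z32 : ∀ c : Site (d + 1), _ := fun c => tsum_left_vertexOfM_word_eq_zero hLc hr0 sf sm 0 hM hδM (hLW μ c) hρα hρβ ν (Sum.inl α) (Sum.inl β)
  have z33 : ∀ c : Site (d + 1), _ := fun c => tsum_left_vertexOfM_word_eq_zero hLc hr0 sf sm 0 hM hδM (hLM μ c) hρα hρβ ν (Sum.inl α) (Sum.inl β)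
  simp only [z13, z23, z31, z32, z33, Finset.sum_const_zero, add_zero, zero_add]
  simp only [symTablesAn1S2_V, swap, z12, z21, z22, add_zero]
  exact z11

end Words

end Summit.QuantumFields.BalabanUV.Beta.GAN24.CombForcingWordsLevelZero

end
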